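import Summits.QuantumFields.BalabanUV.T4Continuum.Support.NE7EtaBackgroundOfRegularMinimisers
import HarnessLib

/-!
# NE7EtaBackgroundReferenceWitness — route #1 of the NE7 crux, stub S7 (NODE O, the BACKGROUND COORDINATE): the END's reference-witness
# binder (F′) `hwit` versus the level-tagged carrier — a LOCATED SEAM DEFECT (no-go for the selections of record) and its REPAIR
# (trivial selections read at tag `0`, one reference datum), with the budget∕sign letters `hγ3`∕`hΛl₁`∕`0 ≤ C`∕`0 < Λ₂′` GONE

Cell `pub-balaban`, rung (B)+1 sub-cell t4, lineage `b2b-balaban-t4-ne7-p1`, generation 55 (CRUX PROVER NE7 #1, ruling e34b3e0c (2)); crux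
skeleton `t4/skeletons/NE7-CRUX-R1.md` v1.7.13 §0bis item 7 ∕ §2 ∕ §5 (G5).  HONEST FRAMING (page 1): FIXED FINITE T⁴, rung (B)+1; NE7, NE3 NOT
PRINTED in [Balaban1984PropagatorsI]–[Balaban1989LargeFieldII] and NOT PROVED here; continuum YM on T⁴ ⇐ BetaPertH ∧ nine spine estimates
(0/9 proved); BetaPertH ⇐ (D1) ∧ (D4) ∧ CAP+tail; G-an2-4 gates asym, D1 and NE2/3/4; NOT infinite volume, NOT mass gap, NOT Clay.

WHAT ([folklore]; 0 def; 0 sorry).  Route #1's term-wise END (`TermwiseLocalThm1LedgerW.goodClause_summable_UN_levels_of_thm1At_residualW`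
down to `T4TermwiseDeviation.centreDeviation_of_witness`) carries the STRUCTURAL binder (F′) `hwit : ∀ K, ∃ v₁ ∈ Adm, uA K v₁ = oneA ∧
uB K v₁ = oneB` with ONE reference background `oneA : C.BgA` for EVERY cutoff; NODE O's background coordinate of record (p258604 → … →
`hclose_of_hmin` p312789) selects into the LEVEL-TAGGED carrier `occCarriers` ((F4) of p258129) with the tag of every selection = the cutoff.
 * §1 `covRoot_mono` — NE3's covariant root (amendment 4) is MONOTONE in `(C, Λ₁, Λ₂′)`; sheds `0 ≤ C`, `0 < Λ₂′` and (with
   `γ := max (C⁺ρ₄) 1`, `l₁ := max Λ₁ 1` chosen in the proof) the budget letters `hγ3`∕`hΛl₁` of the chain.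
 * §2 THE NO-GO (`tag_eq_of_spec`, `not_hwit_of_tag`, **`not_hwit_of_spec`**): selections with the two specification clauses of the chain of
   record admit NO reference witness in the END's shape, for ANY `oneA`, `oneB`, `Adm` (cutoffs `0` and `1` force `oneA.1.1 = 0` and `= 1`):
   the END's (F′), booked under S7 as NODE O's [dict], was UNSATISFIABLE by the coordinate as built — the seam (F′) × (F4) of `CruxDecl_of`
   (skeleton §2, passed «as outline») had never been elaborated as one term.
 * §3 THE REPAIR (`gauge_refPair`, `refPair_isMinimiserPair`, **`hclose_of_hmin_ref`**, **`hwit_of_hmin_ref`**): read EVERY trivial selection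
   at tag `0` — the reference pair `refA = refB = (0, 1)`, gauge-closed to its own transport at distance `0` — and let ONE reference datum
   `v₁` select it AT EVERY CUTOFF; `hclose` VERBATIM; the END's (F′) then holds LITERALLY (`Adm := dom`, `oneA := refA`, `oneB := refB`,
   `v₁ ∈ dom`).  INTENDED `v₁`: the flat datum `1`, whose trivial pair IS a minimiser pair for itself — only its tag moves; for any other `v₁`
   the carve-out is a one-point modification, licensed only if `μ K t τ {v₁} = 0`.  The END's per-datum binders (`hS`, `hnpos`, `hWw′`, …)
   must hold AT `v₁` with the reference backgrounds (their suppliers' business).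
 * §4 **`uRateUpTo_hwit_occCarriers_of_hmin_ref`** — the DOCKING (node U3's `URateUpTo K`, p259051∕p312789 shape) AND (F′) FROM ONE SELECTION.
BILL OF NODE O's BACKGROUND COORDINATE AFTER THIS FILE (closeness, docking, (F′)): row NE3's covariant root (amendment 4, ANY real
`C, Λ₁, Λ₂′`) + row NE3's (H∃) `hmin` + closed-form numerics (`16·C₀·ε ≤ 3`, `2·twoLevelSmall 4 L·ε ≤ L²`, `512·5·8·L²·b ≤ 1`, `0 ≤ b ≤ ε`,
`gradConst 4 c ≤ g`) + `hdom` + the sector condition + `v₁ ∈ dom` — nothing else.  Nothing in the ask of NE3 changes; route 1 stays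
KERNEL-COMPLETE AT FORM LEVEL ∕ DEPENDENT; NE7 NOT proved.  HONEST: bookkeeping over landed modules; the no-go concerns OUR carrier∕END
conventions, not Bałaban; (H∃) and the root are HYPOTHESES asserted for no configuration; nothing of [I]–[III] asserted or discharged.
-/

set_option autoImplicit false

open scoped BigOperators Matrix Matrix.Norms.L2Operator
open Finset NormedSpace

namespace Summit.QuantumFields.BalabanUV.T4Continuum.NE7EtaBackgroundReferenceWitness

open Literature.MathematicalPhysics.QuantumFieldTheory.Balaban1983to89
open B7Prop1Explicit B7Prop2Explicit
open T4AveragingDeficitWall hiding Site Plane Plaq Bond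
open T4AveragingDeficitWallBoundary (periodBox IsPeriodicCfg)
open MinimalActionSandwich (IsMinimiser)
open MinimalActionRate (Regular sfClass)
open MinimalActionRefine (RegularSup gradConst gradConst_nonneg)
open T4OutputRate (Carriers Functional NE9 NE5 LipBackground FadingMemory)
open T4TowerRateComposition (PolyLipGrowth URateUpTo)
open T4CauchySum (InjectedRate)
open AveragingDeficitPeriodicCounting (IsPeriodicDir)
open AveragingDeficitTwoLevelPrep (twoLevelSmall)
open AveragingDeficitMultiLevelPrep (LevelSmall)
open NE3EnergyShapes (residualScale residualScale_nonneg IsUnitarySite IsPeriodicSite)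
open NE3EnergyWeightedShapes (energyNormW)
open AveragingDeficitDualResidual (dualC1 dualC2)
open AveragingDeficitDerivWallProof (wallConst)
open NE7EtaBackgroundCarrier NE7EtaBackgroundCloseness
open TorusSmallFieldGlobalGauge (sectorConst gaugeConst sectorConst_pos)
open NE7EtaBackgroundTowerRate (uRateUpTo_of_hclose)
open NE7EtaBackgroundOfRegularMinimisers (hclose_of_hmin)

noncomputable section

/-! ## §1 The covariant root is monotone in its constants -/

section Mono

variable {d : ℕ} {n : Type*} [Fintype n] [DecidableEq n]

/-- **MONOTONICITY OF NE3's COVARIANT ROOT IN ITS CONSTANTS** (amendment-4 shape = the X-A4 mould, general `d`, class `𝒞`): the root with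
`(C, Λ₁, Λ₂′)` implies the root with any dominating `(C′, Λ₁′, Λ₂″)` (`residualScale ≥ 0`). [folklore] -/
theorem covRoot_mono {𝒞 : ℕ → Set (Site d → Fin d → (Matrix n n ℂ)ˣ)} {L N : ℕ} {b g C C' Λ₁ Λ₁' Λ₂' Λ₂'' : ℝ}
    {dom : Set (Site d → Fin d → (Matrix n n ℂ)ˣ)} (hCC : C ≤ C') (hΛΛ₁ : Λ₁ ≤ Λ₁') (hΛΛ₂ : Λ₂' ≤ Λ₂'')
    (h : ∀ k : ℕ, 1 ≤ k → ∀ V ∈ dom, ∀ UA UB : Site d → Fin d → (Matrix n n ℂ)ˣ,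
      IsMinimiser d 𝒞 L N k V UA → IsMinimiser d 𝒞 L N (k + 1) V UB → Regular d L N b g (k + 1) UB →
        ∃ (u : Site d → (Matrix n n ℂ)ˣ) (Z : Site d → Fin d → Matrix n n ℂ),
          IsUnitarySite u ∧ IsPeriodicSite u ((N * L ^ k : ℕ) : ℤ) ∧
          IsSkewDir Z ∧ IsPeriodicDir Z ((N * L ^ k : ℕ) : ℤ) ∧
          gaugeAct u UA = vary (rescale L (bavg L UB)) Z 1 ∧
          energyNormW L k (rescale L (bavg L UB)) Z (periodBox (N * L ^ k)) ≤ C * residualScale d L N b g k ∧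
          (∀ (κ : Fin d) (x : Site d) (μ : Fin d),
            ‖Ad (rescale L (bavg L UB) (x + e κ) μ) (Z (x + e μ) κ) - Z x κ‖ ≤ Λ₁ * (((L : ℝ)⁻¹) ^ k) ^ 2) ∧
          (∀ (κ μ : Fin d) (y : Site d),
            ‖Ad (rescale L (bavg L UB) (y + e κ) μ)
                (Ad (rescale L (bavg L UB) (y + e κ + e μ) μ) (Z (y + (2 : ℕ) • e μ) κ) - Z (y + e μ) κ)
              - (Ad (rescale L (bavg L UB) (y + e κ) μ) (Z (y + e μ) κ) - Z y κ)‖ ≤ Λ₂' * (((L : ℝ)⁻¹) ^ k) ^ 3)) :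
    ∀ k : ℕ, 1 ≤ k → ∀ V ∈ dom, ∀ UA UB : Site d → Fin d → (Matrix n n ℂ)ˣ,
      IsMinimiser d 𝒞 L N k V UA → IsMinimiser d 𝒞 L N (k + 1) V UB → Regular d L N b g (k + 1) UB →
        ∃ (u : Site d → (Matrix n n ℂ)ˣ) (Z : Site d → Fin d → Matrix n n ℂ),
          IsUnitarySite u ∧ IsPeriodicSite u ((N * L ^ k : ℕ) : ℤ) ∧
          IsSkewDir Z ∧ IsPeriodicDir Z ((N * L ^ k : ℕ) : ℤ) ∧
          gaugeAct u UA = vary (rescale L (bavg L UB)) Z 1 ∧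
          energyNormW L k (rescale L (bavg L UB)) Z (periodBox (N * L ^ k)) ≤ C' * residualScale d L N b g k ∧
          (∀ (κ : Fin d) (x : Site d) (μ : Fin d),
            ‖Ad (rescale L (bavg L UB) (x + e κ) μ) (Z (x + e μ) κ) - Z x κ‖ ≤ Λ₁' * (((L : ℝ)⁻¹) ^ k) ^ 2) ∧
          (∀ (κ μ : Fin d) (y : Site d),
            ‖Ad (rescale L (bavg L UB) (y + e κ) μ)
                (Ad (rescale L (bavg L UB) (y + e κ + e μ) μ) (Z (y + (2 : ℕ) • e μ) κ) - Z (y + e μ) κ)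
              - (Ad (rescale L (bavg L UB) (y + e κ) μ) (Z (y + e μ) κ) - Z y κ)‖ ≤ Λ₂'' * (((L : ℝ)⁻¹) ^ k) ^ 3) := by
  intro k hk V hV UA UB hA hB hreg
  obtain ⟨u, Z, hu, huP, hZ, hZP, hrep, hE, hL1, hL2⟩ := h k hk V hV UA UB hA hB hreg
  have hξ : 0 ≤ ((L : ℝ)⁻¹) ^ k := by positivity
  refine ⟨u, Z, hu, huP, hZ, hZP, hrep, hE.trans (mul_le_mul_of_nonneg_right hCC (residualScale_nonneg d L N b g k)),
    fun κ x μ => (hL1 κ x μ).trans (mul_le_mul_of_nonneg_right hΛΛ₁ (by positivity)),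
    fun κ μ y => (hL2 κ μ y).trans (mul_le_mul_of_nonneg_right hΛΛ₂ (by positivity))⟩

end Mono

variable {n : Type} [Fintype n] [DecidableEq n] [Nonempty n]

/-! ## §2 The no-go: the selections of record admit no level-free reference witness -/

/-- **THE TAG OF EVERY SELECTION OF RECORD IS THE CUTOFF** (from the two specification clauses of p258604 ∕ p310675 ∕ p312789: gauge copies
of a minimiser pair tagged `K` on `K₀ ≤ K ∧ v ∈ dom`, the trivial background `(K, 1)` otherwise). [folklore] -/
theorem tag_eq_of_spec {L N : ℕ} {ε b g : ℝ} {dom : Set (Site 4 → Fin 4 → (Matrix n n ℂ)ˣ)} {D : Type} {sc : D → ℕ}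
    {dl : D → ℝ} {hdl : ∀ X, 0 ≤ dl X}
    {uA : ℕ → (Site 4 → Fin 4 → (Matrix n n ℂ)ˣ) → (occCarriers n L N ε dom D sc dl hdl).BgA}
    {uB : ℕ → (Site 4 → Fin 4 → (Matrix n n ℂ)ˣ) → (occCarriers n L N ε dom D sc dl hdl).BgB} {K₀ : ℕ}
    (hspec : ∀ K : ℕ, K₀ ≤ K → ∀ v ∈ dom, ∃ (UA UB : Site 4 → Fin 4 → (Matrix n n ℂ)ˣ) (wA wB : Site 4 → (Matrix n n ℂ)ˣ),
        IsMinimiser 4 (sfClass 4 L N ε) L N K v UA ∧ IsMinimiser 4 (sfClass 4 L N ε) L N (K + 1) v UB ∧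
        Regular 4 L N b g (K + 1) UB ∧ IsUnitarySite wA ∧ IsPeriodicSite wA ((N * L ^ K : ℕ) : ℤ) ∧
        IsUnitarySite wB ∧ IsPeriodicSite wB ((N * L ^ (K + 1) : ℕ) : ℤ) ∧
        (uA K v).1 = (K, gaugeAct wA UA) ∧ (uB K v).1 = (K, gaugeAct wB UB))
    (hoff : ∀ (K : ℕ) (v : Site 4 → Fin 4 → (Matrix n n ℂ)ˣ), ¬ (K₀ ≤ K ∧ v ∈ dom) →
        (uA K v).1 = (K, 1) ∧ (uB K v).1 = (K, 1)) :
    ∀ (K : ℕ) (v : Site 4 → Fin 4 → (Matrix n n ℂ)ˣ), (uA K v).1.1 = K ∧ (uB K v).1.1 = K := by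
  intro K v
  by_cases hKv : K₀ ≤ K ∧ v ∈ dom
  · obtain ⟨UA, UB, wA, wB, -, -, -, -, -, -, -, hA, hB⟩ := hspec K hKv.1 v hKv.2; exact ⟨by rw [hA], by rw [hB]⟩
  · obtain ⟨hA, hB⟩ := hoff K v hKv; exact ⟨by rw [hA], by rw [hB]⟩

omit [Nonempty n] in
/-- **NO LEVEL-FREE REFERENCE WITNESS FOR LEVEL-TAGGED SELECTIONS**: if the tag of `uA K v` is `K` for all `K`, `v`, the END's binder (F′)
`∀ K, ∃ v₁ ∈ Adm, uA K v₁ = oneA ∧ uB K v₁ = oneB` FAILS for every `oneA`, `oneB`, `uB`, `Adm` (cutoffs `0`, `1`). [folklore] -/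
theorem not_hwit_of_tag {ι : Type*} {admA admB : ℕ → Set (Site 4 → Fin 4 → (Matrix n n ℂ)ˣ)}
    {uA : ℕ → ι → {p : ℕ × (Site 4 → Fin 4 → (Matrix n n ℂ)ˣ) // p.2 ∈ admA p.1}}
    (htag : ∀ (K : ℕ) (v : ι), (uA K v).1.1 = K)
    (uB : ℕ → ι → {p : ℕ × (Site 4 → Fin 4 → (Matrix n n ℂ)ˣ) // p.2 ∈ admB p.1})
    (oneA : {p : ℕ × (Site 4 → Fin 4 → (Matrix n n ℂ)ˣ) // p.2 ∈ admA p.1})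
    (oneB : {p : ℕ × (Site 4 → Fin 4 → (Matrix n n ℂ)ˣ) // p.2 ∈ admB p.1}) (Adm : Set ι) :
    ¬ (∀ K : ℕ, ∃ v₁ ∈ Adm, uA K v₁ = oneA ∧ uB K v₁ = oneB) := by
  intro hwit
  obtain ⟨⟨v₀, -, h0, -⟩, ⟨v₁, -, h1, -⟩⟩ := And.intro (hwit 0) (hwit 1)
  have e0 : oneA.1.1 = 0 := by rw [← h0]; exact htag 0 v₀
  have e1 : oneA.1.1 = 1 := by rw [← h1]; exact htag 1 v₁
  omega

/-- **THE LOCATED SEAM DEFECT (no-go for the chain of record).**  Selections into `occCarriers` with the two specification clauses of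
`hclose_of_covRoot_occ` ∕ `hclose_of_regularSup(_lines)` ∕ `hclose_of_hmin` (p258604 ∕ p266066 ∕ p310675 ∕ p312789) meet the END's binder (F′)
`∀ K, ∃ v₁ ∈ Adm, uA K v₁ = oneA ∧ uB K v₁ = oneB` for NO `oneA`, `oneB`, `Adm`; END ∘ docking needs the re-cut of §3. [folklore] -/
theorem not_hwit_of_spec {L N : ℕ} {ε b g : ℝ} {dom : Set (Site 4 → Fin 4 → (Matrix n n ℂ)ˣ)} {D : Type} {sc : D → ℕ}
    {dl : D → ℝ} {hdl : ∀ X, 0 ≤ dl X}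
    {uA : ℕ → (Site 4 → Fin 4 → (Matrix n n ℂ)ˣ) → (occCarriers n L N ε dom D sc dl hdl).BgA}
    {uB : ℕ → (Site 4 → Fin 4 → (Matrix n n ℂ)ˣ) → (occCarriers n L N ε dom D sc dl hdl).BgB} {K₀ : ℕ}
    (hspec : ∀ K : ℕ, K₀ ≤ K → ∀ v ∈ dom, ∃ (UA UB : Site 4 → Fin 4 → (Matrix n n ℂ)ˣ) (wA wB : Site 4 → (Matrix n n ℂ)ˣ),
        IsMinimiser 4 (sfClass 4 L N ε) L N K v UA ∧ IsMinimiser 4 (sfClass 4 L N ε) L N (K + 1) v UB ∧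
        Regular 4 L N b g (K + 1) UB ∧ IsUnitarySite wA ∧ IsPeriodicSite wA ((N * L ^ K : ℕ) : ℤ) ∧
        IsUnitarySite wB ∧ IsPeriodicSite wB ((N * L ^ (K + 1) : ℕ) : ℤ) ∧
        (uA K v).1 = (K, gaugeAct wA UA) ∧ (uB K v).1 = (K, gaugeAct wB UB))
    (hoff : ∀ (K : ℕ) (v : Site 4 → Fin 4 → (Matrix n n ℂ)ˣ), ¬ (K₀ ≤ K ∧ v ∈ dom) →
        (uA K v).1 = (K, 1) ∧ (uB K v).1 = (K, 1))
    (oneA : (occCarriers n L N ε dom D sc dl hdl).BgA) (oneB : (occCarriers n L N ε dom D sc dl hdl).BgB)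
    (Adm : Set (Site 4 → Fin 4 → (Matrix n n ℂ)ˣ)) :
    ¬ (∀ K : ℕ, ∃ v₁ ∈ Adm, uA K v₁ = oneA ∧ uB K v₁ = oneB) :=
  not_hwit_of_tag (fun K v => (tag_eq_of_spec hspec hoff K v).1) uB oneA oneB Adm

/-! ## §3 The repair: trivial selections read at tag `0`, one reference datum -/

omit [Nonempty n] in
/-- `rescale L (bavg L 1) = 1` (`NE3EnergyShapes.rescale_bavg_flatCfg`, the flat configuration being `1`). [folklore] -/
theorem rescale_bavg_one (L : ℕ) : rescale L (bavg L (1 : Site 4 → Fin 4 → (Matrix n n ℂ)ˣ)) = 1 :=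
  NE3EnergyShapes.rescale_bavg_flatCfg (d := 4) (n := n) L

omit [Nonempty n] in
/-- The plain reading of a pair `(U, U)` vanishes. [folklore] -/
theorem plainReading_self (L N k : ℕ) (U : Site 4 → Fin 4 → (Matrix n n ℂ)ˣ) : plainReading L N k U U = 0 := by
  have hd : diffCfg U U = fun _ _ => 0 := by funext x κ; simp [diffCfg]
  simp [plainReading, reading, hd, supVal, supGrad, Real.iSup_const_zero]

/-- **THE REFERENCE PAIR IS GAUGE-CLOSED AT DISTANCE `0`** on `occCarriers` (`refA = refB = (0, 1)`). [folklore] -/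
theorem gauge_refPair (L N : ℕ) (ε : ℝ) (dom : Set (Site 4 → Fin 4 → (Matrix n n ℂ)ˣ)) (D : Type) (sc : D → ℕ) (dl : D → ℝ)
    (hdl : ∀ X, 0 ≤ dl X) :
    (occCarriers n L N ε dom D sc dl hdl).gauge ⟨((0 : ℕ), (1 : Site 4 → Fin 4 → (Matrix n n ℂ)ˣ)), one_mem_occA L N ε dom 0⟩
        ((occCarriers n L N ε dom D sc dl hdl).transport
          ⟨((0 : ℕ), (1 : Site 4 → Fin 4 → (Matrix n n ℂ)ˣ)), one_mem_occB L N ε dom 0⟩) = 0 := by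
  change levelGauge L N ((0 : ℕ), (1 : Site 4 → Fin 4 → (Matrix n n ℂ)ˣ))
      ((0 : ℕ), rescale L (bavg L (1 : Site 4 → Fin 4 → (Matrix n n ℂ)ˣ))) = 0
  rw [rescale_bavg_one, levelGauge_same, plainReading_self]

/-- **THE REFERENCE PAIR IS A MINIMISER PAIR FOR THE FLAT DATUM** (`MinimalActionWitness.isMinimiser_sfClass_flatCfg` ∕ `regular_flatCfg`):
with the INTENDED reference datum `v₁ = 1` the re-cut of `hclose_of_hmin_ref` moves only the TAG of its selection, not the configurations.
[folklore] -/
theorem refPair_isMinimiserPair {L : ℕ} (hL : 1 ≤ L) (N : ℕ) {ε b g : ℝ} (hε : 0 ≤ ε) (hb : 0 ≤ b) (hg : 0 ≤ g) (K : ℕ) :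
    IsMinimiser 4 (sfClass 4 L N ε) L N K (1 : Site 4 → Fin 4 → (Matrix n n ℂ)ˣ) 1 ∧
      IsMinimiser 4 (sfClass 4 L N ε) L N (K + 1) (1 : Site 4 → Fin 4 → (Matrix n n ℂ)ˣ) 1 ∧
      Regular 4 L N b g (K + 1) (1 : Site 4 → Fin 4 → (Matrix n n ℂ)ˣ) :=
  ⟨MinimalActionWitness.isMinimiser_sfClass_flatCfg (d := 4) (n := n) hL N hε K,
    MinimalActionWitness.isMinimiser_sfClass_flatCfg (d := 4) (n := n) hL N hε (K + 1),
    MinimalActionWitness.regular_flatCfg (d := 4) (n := n) L N (K + 1) hb hg⟩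

/-- **NODE O's `hclose` BINDER RE-CUT WITH A REFERENCE DATUM, ON THE MINIMAL BILL** — `hclose_of_hmin` (p312789) post-processed: every
trivial selection is the tag-`0` reference pair `refA = refB = (0,1)` and the reference datum `v₁` (ANY configuration; the END wants
`v₁ ∈ dom`) selects it AT EVERY CUTOFF; the letters `0 ≤ C`, `0 < Λ₂′`, `0 < γ`, `hγ3`, `0 < l₁`, `hΛl₁` are GONE (`covRoot_mono`;
`γ := max (C⁺·ρ₄) 1`, `l₁ := max Λ₁ 1`).  REMAINING HYPOTHESES: `2 ≤ L`, `1 ≤ N`, `0 < θ`, `θ⁶ = L⁻¹`, `0 ≤ b ≤ ε`, `512·5·8·L²·b ≤ 1`,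
`16·C₀·ε ≤ 3`, `2·twoLevelSmall 4 L·ε ≤ L²`, `gradConst 4 c ≤ g`, `hdom`, row NE3's (H∃) `hmin`, row NE3's covariant root `h` (amendment 4
VERBATIM, ANY real `C, Λ₁, Λ₂′`), the sector condition.  CONCLUSION: selections, `K₀`, ONE `C₃ ≥ 0` with (a) gauge copies of a minimiser pair
for the datum itself on `K₀ ≤ K ∧ v ∈ dom ∧ v ≠ v₁`, (b) the reference pair otherwise, (b′) `v₁` reads the reference pair at every cutoff (for
`v₁ = 1` a minimiser pair for itself, `refPair_isMinimiserPair`), (c) `hclose` VERBATIM (p258604 ∕ p312789). [folklore] -/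
theorem hclose_of_hmin_ref {L N : ℕ} (hL : 2 ≤ L) (hN : 1 ≤ N) {θ : ℝ} (hθ : 0 < θ)
    (hθ6 : θ ^ 6 = ((L : ℝ))⁻¹) {ε b c : ℝ} (hb : 0 ≤ b) (hbε : b ≤ ε)
    (hbs : 512 * (4 + 1) * (4 + 4) * (L : ℝ) ^ 2 * b ≤ 1)
    (hε1 : 16 * C0 4 * ε ≤ 3) (h2line : 2 * twoLevelSmall 4 L * ε ≤ (L : ℝ) ^ 2)
    {g C Λ₁ Λ₂' : ℝ} (hgc : gradConst 4 c ≤ g)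
    {dom : Set (Site 4 → Fin 4 → (Matrix n n ℂ)ˣ)}
    (hdom : ∀ v ∈ dom, ∀ w : Site 4 → (Matrix n n ℂ)ˣ, IsUnitarySite w → IsPeriodicSite w (N : ℤ) → gaugeAct w v ∈ dom)
    (hmin : ∀ V ∈ dom, ∀ k : ℕ, ∃ U, IsMinimiser 4 (sfClass 4 L N ε) L N k V U ∧ RegularSup 4 L N b c k U)
    (h : ∀ k : ℕ, 1 ≤ k → ∀ V ∈ dom, ∀ UA UB : Site 4 → Fin 4 → (Matrix n n ℂ)ˣ,
      IsMinimiser 4 (sfClass 4 L N ε) L N k V UA → IsMinimiser 4 (sfClass 4 L N ε) L N (k + 1) V UB →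
        Regular 4 L N b g (k + 1) UB →
        ∃ (u : Site 4 → (Matrix n n ℂ)ˣ) (Z : Site 4 → Fin 4 → Matrix n n ℂ),
          IsUnitarySite u ∧ IsPeriodicSite u ((N * L ^ k : ℕ) : ℤ) ∧
          IsSkewDir Z ∧ IsPeriodicDir Z ((N * L ^ k : ℕ) : ℤ) ∧
          gaugeAct u UA = vary (rescale L (bavg L UB)) Z 1 ∧
          energyNormW L k (rescale L (bavg L UB)) Z (periodBox (N * L ^ k)) ≤ C * residualScale 4 L N b g k ∧
          (∀ (κ : Fin 4) (x : Site 4) (μ : Fin 4),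
            ‖Ad (rescale L (bavg L UB) (x + e κ) μ) (Z (x + e μ) κ) - Z x κ‖ ≤ Λ₁ * (((L : ℝ)⁻¹) ^ k) ^ 2) ∧
          (∀ (κ μ : Fin 4) (y : Site 4),
            ‖Ad (rescale L (bavg L UB) (y + e κ) μ)
                (Ad (rescale L (bavg L UB) (y + e κ + e μ) μ) (Z (y + (2 : ℕ) • e μ) κ) - Z (y + e μ) κ)
              - (Ad (rescale L (bavg L UB) (y + e κ) μ) (Z (y + e μ) κ) - Z y κ)‖ ≤ Λ₂' * (((L : ℝ)⁻¹) ^ k) ^ 3))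
    (hsector : (Fintype.card n : ℝ) * (N : ℝ) ^ 2 * ε ≤ sectorConst n)
    (v₁ : Site 4 → Fin 4 → (Matrix n n ℂ)ˣ)
    (D : Type) (sc : D → ℕ) (dl : D → ℝ) (hdl : ∀ X, 0 ≤ dl X) :
    ∃ (uA : ℕ → (Site 4 → Fin 4 → (Matrix n n ℂ)ˣ) → (occCarriers n L N ε dom D sc dl hdl).BgA)
      (uB : ℕ → (Site 4 → Fin 4 → (Matrix n n ℂ)ˣ) → (occCarriers n L N ε dom D sc dl hdl).BgB) (K₀ : ℕ) (C₃ : ℝ),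
      0 ≤ C₃ ∧
      (∀ K : ℕ, K₀ ≤ K → ∀ v ∈ dom, v ≠ v₁ → ∃ (UA UB : Site 4 → Fin 4 → (Matrix n n ℂ)ˣ) (wA wB : Site 4 → (Matrix n n ℂ)ˣ),
        IsMinimiser 4 (sfClass 4 L N ε) L N K v UA ∧ IsMinimiser 4 (sfClass 4 L N ε) L N (K + 1) v UB ∧
        Regular 4 L N b g (K + 1) UB ∧ IsUnitarySite wA ∧ IsPeriodicSite wA ((N * L ^ K : ℕ) : ℤ) ∧
        IsUnitarySite wB ∧ IsPeriodicSite wB ((N * L ^ (K + 1) : ℕ) : ℤ) ∧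
        (uA K v).1 = (K, gaugeAct wA UA) ∧ (uB K v).1 = (K, gaugeAct wB UB)) ∧
      (∀ (K : ℕ) (v : Site 4 → Fin 4 → (Matrix n n ℂ)ˣ), ¬ (K₀ ≤ K ∧ v ∈ dom ∧ v ≠ v₁) →
        uA K v = ⟨((0 : ℕ), (1 : Site 4 → Fin 4 → (Matrix n n ℂ)ˣ)), one_mem_occA L N ε dom 0⟩ ∧
        uB K v = ⟨((0 : ℕ), (1 : Site 4 → Fin 4 → (Matrix n n ℂ)ˣ)), one_mem_occB L N ε dom 0⟩) ∧
      (∀ K : ℕ, uA K v₁ = ⟨((0 : ℕ), (1 : Site 4 → Fin 4 → (Matrix n n ℂ)ˣ)), one_mem_occA L N ε dom 0⟩ ∧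
        uB K v₁ = ⟨((0 : ℕ), (1 : Site 4 → Fin 4 → (Matrix n n ℂ)ˣ)), one_mem_occB L N ε dom 0⟩) ∧
      ∀ K : ℕ, ∀ v ∈ dom, (occCarriers n L N ε dom D sc dl hdl).gauge (uA K v)
          ((occCarriers n L N ε dom D sc dl hdl).transport (uB K v))
        ≤ C₃ * θ ^ K := by
  classical
  -- shed the sign letters: the root with `C⁺ := max C 0`, `Λ₂″ := max Λ₂′ 1`
  have hC' : 0 ≤ max C 0 := le_max_right _ _
  have hΛ₂'' : 0 < max Λ₂' 1 := lt_of_lt_of_le one_pos (le_max_right _ _)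
  have h' := covRoot_mono (𝒞 := sfClass 4 L N ε) (le_max_left C 0) (le_refl Λ₁) (le_max_left Λ₂' 1) h
  -- shed the budget letters: choose `γ`, `l₁`
  set ρ₄ : ℝ := wallConst 4 L * (N : ℝ) ^ 2 * (Real.sqrt g * dualC2 4 L + 2 * b ^ 2 * dualC1 4 L) with hρ₄
  set γ : ℝ := max (max C 0 * ρ₄) 1 with hγdef
  have hγ1 : 1 ≤ γ := le_max_right _ _
  have hγ3 : max C 0 * ρ₄ ≤ γ ^ 3 := (le_max_left _ _).trans (le_self_pow₀ hγ1 (by norm_num))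
  set l₁ : ℝ := max Λ₁ 1 with hl₁def
  have hl₁1 : 1 ≤ l₁ := le_max_right _ _
  have hΛl₁ : Λ₁ ≤ l₁ ^ 3 := (le_max_left _ _).trans (le_self_pow₀ hl₁1 (by norm_num))
  -- the chain of record
  obtain ⟨uA, uB, K₀, C₃, hC₃, hspec, hoff, hclose⟩ := hclose_of_hmin hL hN hθ hθ6 hb hbε hbs hε1 h2line hgc hC' hΛ₂'' hdom
    hmin h' (lt_of_lt_of_le one_pos hγ1) hγ3 (lt_of_lt_of_le one_pos hl₁1) hΛl₁ hsector D sc dl hdl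
  -- the re-cut selections
  refine ⟨fun K v => if K₀ ≤ K ∧ v ∈ dom ∧ v ≠ v₁ then uA K v
      else ⟨((0 : ℕ), (1 : Site 4 → Fin 4 → (Matrix n n ℂ)ˣ)), one_mem_occA L N ε dom 0⟩,
    fun K v => if K₀ ≤ K ∧ v ∈ dom ∧ v ≠ v₁ then uB K v
      else ⟨((0 : ℕ), (1 : Site 4 → Fin 4 → (Matrix n n ℂ)ˣ)), one_mem_occB L N ε dom 0⟩, K₀, C₃, hC₃, ?_, ?_, ?_, ?_⟩
  · -- (a) gauge copies of a minimiser pair for the datum itself, off the reference datum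
    intro K hK v hv hne
    have hKv : K₀ ≤ K ∧ v ∈ dom ∧ v ≠ v₁ := ⟨hK, hv, hne⟩
    obtain ⟨UA, UB, wA, wB, hA, hB, hreg, hwAu, hwAp, hwBu, hwBp, heA, heB⟩ := hspec K hK v hv
    refine ⟨UA, UB, wA, wB, hA, hB, hreg, hwAu, hwAp, hwBu, hwBp, ?_, ?_⟩
    · simp only [if_pos hKv]; exact heA
    · simp only [if_pos hKv]; exact heB
  · -- (b) the reference pair otherwise
    intro K v hKv
    exact ⟨by simp only [if_neg hKv], by simp only [if_neg hKv]⟩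
  · -- (b′) the reference datum reads the reference pair at every cutoff
    intro K
    have hKv : ¬ (K₀ ≤ K ∧ v₁ ∈ dom ∧ v₁ ≠ v₁) := fun h => h.2.2 rfl
    exact ⟨by simp only [if_neg hKv], by simp only [if_neg hKv]⟩
  · -- (c) `hclose`
    intro K v hv
    by_cases hKv : K₀ ≤ K ∧ v ∈ dom ∧ v ≠ v₁
    · simp only [if_pos hKv]
      exact hclose K v hv
    · simp only [if_neg hKv]
      rw [gauge_refPair]
      positivity

/-- **THE END's REFERENCE WITNESS (F′) ON NODE O's CARRIER, IN THE END's OWN SHAPE** (`Adm := dom`, `oneA := refA`, `oneB := refB`,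
`v₁ ∈ dom`): selections carrying `hclose` VERBATIM AND `∀ K, ∃ v ∈ dom, uA K v = oneA ∧ uB K v = oneB` — LITERALLY the `hwit` of
`TermwiseLocalThm1LedgerW.goodClause_summable_UN_levels_of_thm1At_residualW`; by `not_hwit_of_spec` the selections of record could not. [folklore] -/
theorem hwit_of_hmin_ref {L N : ℕ} (hL : 2 ≤ L) (hN : 1 ≤ N) {θ : ℝ} (hθ : 0 < θ)
    (hθ6 : θ ^ 6 = ((L : ℝ))⁻¹) {ε b c : ℝ} (hb : 0 ≤ b) (hbε : b ≤ ε)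
    (hbs : 512 * (4 + 1) * (4 + 4) * (L : ℝ) ^ 2 * b ≤ 1)
    (hε1 : 16 * C0 4 * ε ≤ 3) (h2line : 2 * twoLevelSmall 4 L * ε ≤ (L : ℝ) ^ 2)
    {g C Λ₁ Λ₂' : ℝ} (hgc : gradConst 4 c ≤ g)
    {dom : Set (Site 4 → Fin 4 → (Matrix n n ℂ)ˣ)}
    (hdom : ∀ v ∈ dom, ∀ w : Site 4 → (Matrix n n ℂ)ˣ, IsUnitarySite w → IsPeriodicSite w (N : ℤ) → gaugeAct w v ∈ dom)
    (hmin : ∀ V ∈ dom, ∀ k : ℕ, ∃ U, IsMinimiser 4 (sfClass 4 L N ε) L N k V U ∧ RegularSup 4 L N b c k U)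
    (h : ∀ k : ℕ, 1 ≤ k → ∀ V ∈ dom, ∀ UA UB : Site 4 → Fin 4 → (Matrix n n ℂ)ˣ,
      IsMinimiser 4 (sfClass 4 L N ε) L N k V UA → IsMinimiser 4 (sfClass 4 L N ε) L N (k + 1) V UB →
        Regular 4 L N b g (k + 1) UB →
        ∃ (u : Site 4 → (Matrix n n ℂ)ˣ) (Z : Site 4 → Fin 4 → Matrix n n ℂ),
          IsUnitarySite u ∧ IsPeriodicSite u ((N * L ^ k : ℕ) : ℤ) ∧
          IsSkewDir Z ∧ IsPeriodicDir Z ((N * L ^ k : ℕ) : ℤ) ∧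
          gaugeAct u UA = vary (rescale L (bavg L UB)) Z 1 ∧
          energyNormW L k (rescale L (bavg L UB)) Z (periodBox (N * L ^ k)) ≤ C * residualScale 4 L N b g k ∧
          (∀ (κ : Fin 4) (x : Site 4) (μ : Fin 4),
            ‖Ad (rescale L (bavg L UB) (x + e κ) μ) (Z (x + e μ) κ) - Z x κ‖ ≤ Λ₁ * (((L : ℝ)⁻¹) ^ k) ^ 2) ∧
          (∀ (κ μ : Fin 4) (y : Site 4),
            ‖Ad (rescale L (bavg L UB) (y + e κ) μ)
                (Ad (rescale L (bavg L UB) (y + e κ + e μ) μ) (Z (y + (2 : ℕ) • e μ) κ) - Z (y + e μ) κ)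
              - (Ad (rescale L (bavg L UB) (y + e κ) μ) (Z (y + e μ) κ) - Z y κ)‖ ≤ Λ₂' * (((L : ℝ)⁻¹) ^ k) ^ 3))
    (hsector : (Fintype.card n : ℝ) * (N : ℝ) ^ 2 * ε ≤ sectorConst n)
    {v₁ : Site 4 → Fin 4 → (Matrix n n ℂ)ˣ} (hv₁ : v₁ ∈ dom)
    (D : Type) (sc : D → ℕ) (dl : D → ℝ) (hdl : ∀ X, 0 ≤ dl X) :
    ∃ (uA : ℕ → (Site 4 → Fin 4 → (Matrix n n ℂ)ˣ) → (occCarriers n L N ε dom D sc dl hdl).BgA)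
      (uB : ℕ → (Site 4 → Fin 4 → (Matrix n n ℂ)ˣ) → (occCarriers n L N ε dom D sc dl hdl).BgB)
      (oneA : (occCarriers n L N ε dom D sc dl hdl).BgA) (oneB : (occCarriers n L N ε dom D sc dl hdl).BgB) (C₃ : ℝ),
      0 ≤ C₃ ∧
      (∀ K : ℕ, ∀ v ∈ dom, (occCarriers n L N ε dom D sc dl hdl).gauge (uA K v)
          ((occCarriers n L N ε dom D sc dl hdl).transport (uB K v)) ≤ C₃ * θ ^ K) ∧
      (∀ K : ℕ, ∃ v ∈ dom, uA K v = oneA ∧ uB K v = oneB) := by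
  obtain ⟨uA, uB, K₀, C₃, hC₃, -, -, href, hclose⟩ := hclose_of_hmin_ref hL hN hθ hθ6 hb hbε hbs hε1 h2line hgc hdom hmin h
    hsector v₁ D sc dl hdl
  exact ⟨uA, uB, _, _, C₃, hC₃, hclose, fun K => ⟨v₁, hv₁, (href K).1, (href K).2⟩⟩

/-! ## §4 The docking and the END's witness from ONE selection, on the reduced bill -/

/-- **ROUTE #1's NODE-U3 RATE ALONG THE TOWER ON `occCarriers` TOGETHER WITH THE END's REFERENCE WITNESS (F′), FROM ONE SELECTION** —
`hwit_of_hmin_ref` ∘ `NE7EtaBackgroundTowerRate.uRateUpTo_of_hclose`: hypotheses = NE3's covariant root (amendment 4, any real constants),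
NE3's (H∃) `hmin`, `hdom`, closed-form numerics, the sector condition, `v₁ ∈ dom`, node U3's shapes (`NE9`∕`FadingMemory`,
`LipBackground`∕`PolyLipGrowth`, `NE5`), node U2's `InjectedRate`, box∕window letters, ANY common rate `θ' ≥ θ = L^{−1∕6}`.  CONCLUSION:
`uA uB oneA oneB`, ONE `a ≥ 0`, `URateUpTo K …` FOR EVERY CUTOFF (the END's `hUR` shape on this carrier) AND
`∀ K, ∃ v₁ ∈ dom, uA K v₁ = oneA ∧ uB K v₁ = oneB` (the END's `hwit` shape).  HONEST: every analytic input is a HYPOTHESIS; `EA`, `EB`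
ABSTRACT (X-A2); nothing of NE3∕NE5∕NE9∕NE7 discharged. [folklore] -/
theorem uRateUpTo_hwit_occCarriers_of_hmin_ref {L N : ℕ} (hL : 2 ≤ L) (hN : 1 ≤ N) {θ : ℝ} (hθ : 0 < θ)
    (hθ6 : θ ^ 6 = ((L : ℝ))⁻¹) {ε b c : ℝ} (hb : 0 ≤ b) (hbε : b ≤ ε)
    (hbs : 512 * (4 + 1) * (4 + 4) * (L : ℝ) ^ 2 * b ≤ 1)
    (hε1 : 16 * C0 4 * ε ≤ 3) (h2line : 2 * twoLevelSmall 4 L * ε ≤ (L : ℝ) ^ 2)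
    {g C Λ₁ Λ₂' : ℝ} (hgc : gradConst 4 c ≤ g)
    {dom : Set (Site 4 → Fin 4 → (Matrix n n ℂ)ˣ)}
    (hdom : ∀ v ∈ dom, ∀ w : Site 4 → (Matrix n n ℂ)ˣ, IsUnitarySite w → IsPeriodicSite w (N : ℤ) → gaugeAct w v ∈ dom)
    (hmin : ∀ V ∈ dom, ∀ k : ℕ, ∃ U, IsMinimiser 4 (sfClass 4 L N ε) L N k V U ∧ RegularSup 4 L N b c k U)
    (h : ∀ k : ℕ, 1 ≤ k → ∀ V ∈ dom, ∀ UA UB : Site 4 → Fin 4 → (Matrix n n ℂ)ˣ,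
      IsMinimiser 4 (sfClass 4 L N ε) L N k V UA → IsMinimiser 4 (sfClass 4 L N ε) L N (k + 1) V UB →
        Regular 4 L N b g (k + 1) UB →
        ∃ (u : Site 4 → (Matrix n n ℂ)ˣ) (Z : Site 4 → Fin 4 → Matrix n n ℂ),
          IsUnitarySite u ∧ IsPeriodicSite u ((N * L ^ k : ℕ) : ℤ) ∧
          IsSkewDir Z ∧ IsPeriodicDir Z ((N * L ^ k : ℕ) : ℤ) ∧
          gaugeAct u UA = vary (rescale L (bavg L UB)) Z 1 ∧
          energyNormW L k (rescale L (bavg L UB)) Z (periodBox (N * L ^ k)) ≤ C * residualScale 4 L N b g k ∧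
          (∀ (κ : Fin 4) (x : Site 4) (μ : Fin 4),
            ‖Ad (rescale L (bavg L UB) (x + e κ) μ) (Z (x + e μ) κ) - Z x κ‖ ≤ Λ₁ * (((L : ℝ)⁻¹) ^ k) ^ 2) ∧
          (∀ (κ μ : Fin 4) (y : Site 4),
            ‖Ad (rescale L (bavg L UB) (y + e κ) μ)
                (Ad (rescale L (bavg L UB) (y + e κ + e μ) μ) (Z (y + (2 : ℕ) • e μ) κ) - Z (y + e μ) κ)
              - (Ad (rescale L (bavg L UB) (y + e κ) μ) (Z (y + e μ) κ) - Z y κ)‖ ≤ Λ₂' * (((L : ℝ)⁻¹) ^ k) ^ 3))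
    (hsector : (Fintype.card n : ℝ) * (N : ℝ) ^ 2 * ε ≤ sectorConst n)
    {v₁ : Site 4 → Fin 4 → (Matrix n n ℂ)ˣ} (hv₁ : v₁ ∈ dom)
    (D : Type) (sc : D → ℕ) (dl : D → ℝ) (hdl : ∀ X, 0 ≤ dl X)
    -- node U3's shapes on the carrier, node U2's output, the window, the common rate
    {W : Set (ℕ → ℝ)} {EA : Functional (occCarriers n L N ε dom D sc dl hdl) (occCarriers n L N ε dom D sc dl hdl).BgA}
    {EB : Functional (occCarriers n L N ε dom D sc dl hdl) (occCarriers n L N ε dom D sc dl hdl).BgB}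
    {κ θ₅ C₅ C₉ ω θc Cd γg P θ' : ℝ} {q : ℕ} {Λ : ℕ → ℕ → ℝ} {CU : (ℕ → ℝ) → ℕ → ℝ} {gtab : ℕ → ℕ → ℝ}
    (h9 : NE9 EA W κ Λ) (hΛ : FadingMemory C₉ ω Λ) (hω : 0 ≤ ω)
    (hU : LipBackground EA W κ CU) (hG : PolyLipGrowth CU gtab P q) (hP : 0 ≤ P)
    (h5 : NE5 EA EB W κ θ₅ C₅) (hθ₅ : 0 ≤ θ₅) (hC₅ : 0 ≤ C₅)
    (hinj : InjectedRate Cd 0 θc (fun K j => T4CouplingMatching.disc (gtab K) (gtab (K + 1)) j)) (hCd : 0 ≤ Cd)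
    (hθc : 0 ≤ θc) (hbox : ∀ K i, i ≤ K → 0 < gtab K i ∧ gtab K i ≤ γg)
    (hgA : ∀ K, gtab K ∈ W) (hgB : ∀ K, (fun i => gtab (K + 1) (i + 1)) ∈ W)
    (hθ' : max ω θc < θ') (hθ₅' : θ₅ ≤ θ') (hθθ' : θ ≤ θ') :
    ∃ (uA : ℕ → (Site 4 → Fin 4 → (Matrix n n ℂ)ˣ) → (occCarriers n L N ε dom D sc dl hdl).BgA)
      (uB : ℕ → (Site 4 → Fin 4 → (Matrix n n ℂ)ˣ) → (occCarriers n L N ε dom D sc dl hdl).BgB)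
      (oneA : (occCarriers n L N ε dom D sc dl hdl).BgA) (oneB : (occCarriers n L N ε dom D sc dl hdl).BgB) (a : ℝ),
      0 ≤ a ∧
      (∀ K : ℕ, URateUpTo K EA EB (gtab K) (fun i => gtab (K + 1) (i + 1)) (uA K) (uB K) dom
        (a + C₉ * (γg ^ 3 * Cd) * (θ' / (θ' - max ω θc)) + C₅) θ' κ) ∧
      (∀ K : ℕ, ∃ v₁ ∈ dom, uA K v₁ = oneA ∧ uB K v₁ = oneB) := by
  obtain ⟨uA, uB, oneA, oneB, C₃, hC₃, hclose, hwit⟩ := hwit_of_hmin_ref hL hN hθ hθ6 hb hbε hbs hε1 h2line hgc hdom hmin h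
    hsector hv₁ D sc dl hdl
  obtain ⟨a, ha, hrate⟩ := uRateUpTo_of_hclose h9 hΛ hω hU hG hP h5 hθ₅ hC₅ hclose hC₃ hθ.le (theta_lt_one hL hθ hθ6) hinj hCd
    hθc hbox hgA hgB hθ' hθ₅' hθθ'
  exact ⟨uA, uB, oneA, oneB, a, ha, hrate, hwit⟩

end

end Summit.QuantumFields.BalabanUV.T4Continuum.NE7EtaBackgroundReferenceWitness
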